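import Summits.BirchSwinnertonDyer.BirchSwinnertonDyer.Theorems.ErratumRoadFiveNonSurjCornerSevenJLine
import Literature.NumberTheory.EllipticCurves.Fouquet2025.Assumption34TwistLocusProofs
import Literature.NumberTheory.EllipticCurves.BSDSelmerSkinnerThmBProofs
import Literature.NumberTheory.EllipticCurves.X1ElevenKummerValues
import HarnessLib

/-!
# Route `ErratumRoadFive` (rung K2), crux `NonSurjCorner` (item stmt-BirchSwinnertonDyer-19065):
# THE PARAMETER `t` OF A CORNER PAIR AT `7` — on Zywina's `J₂`-line (`X_{N_s(7)}`) a multiplicative `7` forces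
# `v₇(t) < 0`, and then `ord₇ Δ_min = −7·v₇(t)`: the crux binder `7 ∣ ord₇ Δ_min` (and `ord₇ Δ_min ≥ 7`) read off
# the parametrisation (cell `bsd-stepL`, seat `bsd-stepL-corner5-p2` g6, WIDTH-LEVER lane B;
# `--supports stmt-BirchSwinnertonDyer-19065 --as helper`)

WHY THIS FILE. The `p = 7` twin of this lane's `…NonSurjCornerFiveJLineParameter` (g5, p573872). `…NonSurjCornerSevenJLine`
(g4, p559240) gives every corner pair at `7` a parameter `t ∈ ℚ` with `j(E)·c(t)⁷ = n(t)`,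
`c(t) = t³ − 4t² + 3t + 1 ≠ 0`, `n(t) = t(t+1)³(t²−5t+1)³(t²−5t+8)³(t⁴−5t³+8t²−7t+7)³` (Zywina Thm. 1.5, `i = 2`, by name).
Unlike `J₉` at `5`, `J₂` has a DENOMINATOR, and `7`-adically the cusp `c(t) = 0` and `t = ∞` interact: `c ≡ (t+1)³`,
`n ≡ t⁷(t+1)²¹ (mod 7)`. This file computes the `7`-adic shape of `t` from the single local fact that `7` is MULTIPLICATIVE
(`v₇(j) = −v₇(Δ_min) < 0`, tree theorem `Fouquet2025.padicValRat_j_of_hasMultiplicativeReductionAtPrime`):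

* `padicValRat_J2_of_neg` — for `v₇(t) < 0`: `v₇(c(t)) = 3v₇(t)`, `v₇(n(t)) = 28v₇(t)`, so `v₇(j) = 7·v₇(t)`;
* `padicValRat_J2_nonneg_of_nonneg` — for `v₇(t) ≥ 0`: `v₇(j) ≥ 0` (if `7 ∣ c(t)` then `v₇(t+1) ≥ 1`, `v₇(t) = 0`, `v₇(c) = 1`
  EXACTLY as `c = (t+1)³ − 7t²`, while `t²−5t+1 = (t+1)² − 7t`, `t²−5t+8 = (t+1)² − 7(t−1)`,
  `t⁴−5t³+8t²−7t+7 = t²(t+1)² − 7(t−1)(t²+1)` give `v₇(n) ≥ 12 > 7`: the points `7`-adically near the cusps of `c` have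
  POTENTIALLY GOOD reduction at `7`);
* **`padicValRat_lt_zero_of_mult_of_j_eq_J2`** ∕ **`ordMinimalDiscriminant_eq_of_mult_of_j_eq_J2`**: `Mult W 7` and
  `j(W)·c(t)⁷ = n(t)` (`c(t) ≠ 0`) ⟹ `v₇(t) < 0` and `v₇(Δ_min(W)) = −7·v₇(t)`; hence `7 ∣ v₇(Δ_min)`, `7 ≤ v₇(Δ_min)` — every
  known corner member at `7` has `v₇(t) = −1`, `v₇(Δ_min) = 7` (kit j291808, j292206–15);
* **`NonSurjCorner.exists_t_seven`**: every corner pair at `7` has such a `t` (mod Zywina's fact by name, `hZ`). With g5's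
  `exists_t_five`: ON BOTH CORNER LINES a multiplicative `p` IS `v_p(t) < 0`, and `ord_p Δ_min = p·|v_p(t)|` — the binder
  `p ∣ ord_p Δ_min` is the ramification index `p` of the `j`-map at the cusp `t = ∞` of `X_{G₉}` resp. `X_{N_s(7)}`.

HONEST FRAMING: elementary valuation bookkeeping + the imported structure theorems; nothing here proves the crux, a
registered stub or BSD for any class; no census number moves (T7).
References: [Zywina2015] §1.4 (`J₂`), Thm. 1.5; [SilvermanAEC2009] VII.5 Prop. 5.1 (`v(j) < 0` at a multiplicative prime);
[Fouquet2025] (the tree's `v_q(j) = −v_q(Δ_min)` lemma).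
-/

set_option linter.dupNamespace false -- `Summit.BirchSwinnertonDyer.BirchSwinnertonDyer` (summit = problem), tree-wide

noncomputable section

open scoped Classical

namespace Summit.BirchSwinnertonDyer.BirchSwinnertonDyer.Theorems.CornerShape

open WeierstrassCurve
  Literature.NumberTheory.EllipticCurves
  Literature.NumberTheory.EllipticCurves.Rank1Residual
  Summit.BirchSwinnertonDyer.Rank1Residual

/-! ### §0. Small valuation helpers (the `≥ 0` closure lemmas are the tree's `X1Eleven.padicValRat_{mul,pow}_nonneg`) -/

section Helpers

variable {p : ℕ} [Fact p.Prime]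

/-- `v_p(q + r) ≥ n` from `v_p(q) ≥ n`, `v_p(r) ≥ n` when `n ≤ 0` (no non-vanishing needed). [folklore] -/
theorem le_padicValRat_add_of_nonpos {q r : ℚ} {n : ℤ} (hn : n ≤ 0) (hq : n ≤ padicValRat p q)
    (hr : n ≤ padicValRat p r) : n ≤ padicValRat p (q + r) := by
  by_cases h : q + r = 0
  · rw [h, padicValRat.zero]; exact hn
  · exact le_trans (le_min hq hr) (padicValRat.min_le_padicValRat_add h)

/-- `v_p(q + r) ≥ n` from `v_p(q) ≥ n`, `v_p(r) ≥ n` when `q + r ≠ 0`. [folklore] -/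
theorem le_padicValRat_add_of_ne_zero {q r : ℚ} {n : ℤ} (h : q + r ≠ 0) (hq : n ≤ padicValRat p q)
    (hr : n ≤ padicValRat p r) : n ≤ padicValRat p (q + r) :=
  le_trans (le_min hq hr) (padicValRat.min_le_padicValRat_add h)

/-- `v_p(q·r) = v_p(q) + v_p(r)` packaged with the zero cases for lower bounds: `v_p(q) ≥ a ≥ 0`, `v_p(r) ≥ b ≥ 0`
⟹ `v_p(qr) ≥ a + b` provided `q r ≠ 0`. [folklore] -/
theorem le_padicValRat_mul {q r : ℚ} {a b : ℤ} (hq0 : q ≠ 0) (hr0 : r ≠ 0) (hq : a ≤ padicValRat p q)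
    (hr : b ≤ padicValRat p r) : a + b ≤ padicValRat p (q * r) := by
  rw [padicValRat.mul hq0 hr0]; exact add_le_add hq hr

end Helpers

/-! ### §1. `7`-adic valuation of `J₂(t)`: the factors -/

section Factors

/-- `v₇(5) = 0`, `v₇(8) = 0`, `v₇(4) = 0`, `v₇(3) = 0` and `v₇(7) = 1` as rational valuations. [folklore] -/
theorem padicValRat_seven_consts :
    padicValRat 7 (5 : ℚ) = 0 ∧ padicValRat 7 (8 : ℚ) = 0 ∧ padicValRat 7 (4 : ℚ) = 0 ∧
      padicValRat 7 (3 : ℚ) = 0 ∧ padicValRat 7 (7 : ℚ) = 1 := by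
  haveI : Fact (Nat.Prime 7) := ⟨by norm_num⟩
  refine ⟨?_, ?_, ?_, ?_, ?_⟩
  · rw [show (5 : ℚ) = ((5 : ℕ) : ℚ) by norm_num, padicValRat.of_nat]; norm_num [padicValNat.eq_zero_of_not_dvd]
  · rw [show (8 : ℚ) = ((8 : ℕ) : ℚ) by norm_num, padicValRat.of_nat]; norm_num [padicValNat.eq_zero_of_not_dvd]
  · rw [show (4 : ℚ) = ((4 : ℕ) : ℚ) by norm_num, padicValRat.of_nat]; norm_num [padicValNat.eq_zero_of_not_dvd]
  · rw [show (3 : ℚ) = ((3 : ℕ) : ℚ) by norm_num, padicValRat.of_nat]; norm_num [padicValNat.eq_zero_of_not_dvd]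
  · rw [show (7 : ℚ) = ((7 : ℕ) : ℚ) by norm_num, padicValRat.self (by norm_num)]

variable {t : ℚ}

/-- For `v₇(t) < 0`: `v₇(t + 1) = v₇(t)`. [folklore] -/
theorem padicValRat_t_add_one_of_neg (ht : padicValRat 7 t < 0) (h0 : t + 1 ≠ 0) :
    padicValRat 7 (t + 1) = padicValRat 7 t := by
  haveI : Fact (Nat.Prime 7) := ⟨by norm_num⟩
  have ht0 : t ≠ 0 := by rintro rfl; simp at ht
  exact padicValRat.add_eq_of_lt h0 ht0 one_ne_zero (by rwa [padicValRat.one])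

/-- For `v₇(t) < 0` and a `7`-adic unit constant `b`: `v₇(t² − 5t + b) = 2·v₇(t)` (`t²` dominates `−5t + b`, which has
valuation `v₇(t)`). Used with `b = 1` and `b = 8`. [folklore] -/
theorem padicValRat_quad_of_neg (ht : padicValRat 7 t < 0) {b : ℚ} (hb0 : b ≠ 0) (hb : padicValRat 7 b = 0)
    (hA : t ^ 2 - 5 * t + b ≠ 0) : padicValRat 7 (t ^ 2 - 5 * t + b) = 2 * padicValRat 7 t := by
  haveI : Fact (Nat.Prime 7) := ⟨by norm_num⟩
  have ht0 : t ≠ 0 := by rintro rfl; simp at ht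
  have h5 := padicValRat_seven_consts.1
  have h5t : padicValRat 7 (-(5 * t)) = padicValRat 7 t := by
    rw [padicValRat.neg, padicValRat.mul (by norm_num) ht0, h5, zero_add]
  have hne : -(5 * t) + b ≠ 0 := by
    intro h
    have : t = b / 5 := by linarith
    rw [this, padicValRat.div hb0 (by norm_num), hb, h5] at ht; simp at ht
  have hlin : padicValRat 7 (-(5 * t) + b) = padicValRat 7 t := by
    rw [padicValRat.add_eq_of_lt hne (by simpa using ht0) hb0 (by rw [h5t, hb]; exact ht), h5t]
  have heq : t ^ 2 - 5 * t + b = t ^ 2 + (-(5 * t) + b) := by ring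
  have ht2 : padicValRat 7 (t ^ 2) = 2 * padicValRat 7 t := by rw [padicValRat.pow]; push_cast; ring
  rw [heq, padicValRat.add_eq_of_lt (heq ▸ hA) (pow_ne_zero 2 ht0) hne (by rw [ht2, hlin]; linarith), ht2]

/-- For `v₇(t) < 0`: `v₇(t⁴ − 5t³ + 8t² − 7t + 7) = 4·v₇(t)` (the lower terms have valuation `≥ 3·v₇(t) > 4·v₇(t)`). [folklore] -/
theorem padicValRat_Q_of_neg (ht : padicValRat 7 t < 0) (hQ : t ^ 4 - 5 * t ^ 3 + 8 * t ^ 2 - 7 * t + 7 ≠ 0) :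
    padicValRat 7 (t ^ 4 - 5 * t ^ 3 + 8 * t ^ 2 - 7 * t + 7) = 4 * padicValRat 7 t := by
  haveI : Fact (Nat.Prime 7) := ⟨by norm_num⟩
  have ht0 : t ≠ 0 := by rintro rfl; simp at ht
  obtain ⟨h5, h8, -, -, h7⟩ := padicValRat_seven_consts
  have ht4 : padicValRat 7 (t ^ 4) = 4 * padicValRat 7 t := by rw [padicValRat.pow]; push_cast; ring
  -- lower terms `L = -5t³ + 8t² - 7t + 7` have `v ≥ 3 v(t)`
  have hL : 3 * padicValRat 7 t ≤ padicValRat 7 (-5 * t ^ 3 + 8 * t ^ 2 + (-7 * t + 7)) := by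
    have h3 : (3 : ℤ) * padicValRat 7 t ≤ 0 := by linarith
    refine le_padicValRat_add_of_nonpos h3 (le_padicValRat_add_of_nonpos h3 ?_ ?_) (le_padicValRat_add_of_nonpos h3 ?_ ?_)
    · rw [padicValRat.mul (by norm_num) (pow_ne_zero 3 ht0), show (-5 : ℚ) = -(5 : ℚ) by norm_num, padicValRat.neg, h5,
        padicValRat.pow]; push_cast; linarith
    · rw [padicValRat.mul (by norm_num) (pow_ne_zero 2 ht0), h8, padicValRat.pow]; push_cast; linarith
    · rw [padicValRat.mul (by norm_num) ht0, show (-7 : ℚ) = -(7 : ℚ) by norm_num, padicValRat.neg, h7]; linarith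
    · rw [h7]; linarith
  have heq : t ^ 4 - 5 * t ^ 3 + 8 * t ^ 2 - 7 * t + 7 = t ^ 4 + (-5 * t ^ 3 + 8 * t ^ 2 + (-7 * t + 7)) := by ring
  by_cases hL0 : (-5 * t ^ 3 + 8 * t ^ 2 + (-7 * t + 7) : ℚ) = 0
  · rw [heq, hL0, add_zero, ht4]
  rw [heq, padicValRat.add_eq_of_lt (heq ▸ hQ) (pow_ne_zero 4 ht0) hL0 (by rw [ht4]; linarith), ht4]

/-- For `v₇(t) < 0`: `v₇(t³ − 4t² + 3t + 1) = 3·v₇(t)` (the lower terms have valuation `≥ 2·v₇(t) > 3·v₇(t)`). [folklore] -/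
theorem padicValRat_c_of_neg (ht : padicValRat 7 t < 0) (hc : t ^ 3 - 4 * t ^ 2 + 3 * t + 1 ≠ 0) :
    padicValRat 7 (t ^ 3 - 4 * t ^ 2 + 3 * t + 1) = 3 * padicValRat 7 t := by
  haveI : Fact (Nat.Prime 7) := ⟨by norm_num⟩
  have ht0 : t ≠ 0 := by rintro rfl; simp at ht
  obtain ⟨-, -, h4, h3, -⟩ := padicValRat_seven_consts
  have ht3 : padicValRat 7 (t ^ 3) = 3 * padicValRat 7 t := by rw [padicValRat.pow]; push_cast; ring
  have hL : 2 * padicValRat 7 t ≤ padicValRat 7 (-4 * t ^ 2 + (3 * t + 1)) := by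
    have h2 : (2 : ℤ) * padicValRat 7 t ≤ 0 := by linarith
    refine le_padicValRat_add_of_nonpos h2 ?_ (le_padicValRat_add_of_nonpos h2 ?_ ?_)
    · rw [padicValRat.mul (by norm_num) (pow_ne_zero 2 ht0), show (-4 : ℚ) = -(4 : ℚ) by norm_num, padicValRat.neg, h4,
        padicValRat.pow]; push_cast; linarith
    · rw [padicValRat.mul (by norm_num) ht0, h3]; linarith
    · rw [padicValRat.one]; linarith
  have heq : t ^ 3 - 4 * t ^ 2 + 3 * t + 1 = t ^ 3 + (-4 * t ^ 2 + (3 * t + 1)) := by ring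
  by_cases hL0 : (-4 * t ^ 2 + (3 * t + 1) : ℚ) = 0
  · rw [heq, hL0, add_zero, ht3]
  rw [heq, padicValRat.add_eq_of_lt (heq ▸ hc) (pow_ne_zero 3 ht0) hL0 (by rw [ht3]; linarith), ht3]

/-- **For `v₇(t) < 0`: `v₇(j) = 7·v₇(t)`** whenever `j·c(t)⁷ = n(t)` with `j ≠ 0`, `c(t) ≠ 0` (`v(n) = 28v(t)`,
`v(c⁷) = 21v(t)`). [cite: Zywina2015, §1.4 (J₂)] -/
theorem padicValRat_J2_of_neg (ht : padicValRat 7 t < 0) {j : ℚ} (hj : j ≠ 0)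
    (hc : t ^ 3 - 4 * t ^ 2 + 3 * t + 1 ≠ 0) (hid : j * (t ^ 3 - 4 * t ^ 2 + 3 * t + 1) ^ 7 = t * (t + 1) ^ 3 *
      (t ^ 2 - 5 * t + 1) ^ 3 * (t ^ 2 - 5 * t + 8) ^ 3 * (t ^ 4 - 5 * t ^ 3 + 8 * t ^ 2 - 7 * t + 7) ^ 3) :
    padicValRat 7 j = 7 * padicValRat 7 t := by
  haveI : Fact (Nat.Prime 7) := ⟨by norm_num⟩
  have hn0 : t * (t + 1) ^ 3 * (t ^ 2 - 5 * t + 1) ^ 3 * (t ^ 2 - 5 * t + 8) ^ 3 *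
      (t ^ 4 - 5 * t ^ 3 + 8 * t ^ 2 - 7 * t + 7) ^ 3 ≠ 0 := hid ▸ mul_ne_zero hj (pow_ne_zero 7 hc)
  have ht0 : t ≠ 0 := by intro h; apply hn0; simp [h]
  have h1 : t + 1 ≠ 0 := by intro h; apply hn0; simp [h]
  have hA : t ^ 2 - 5 * t + 1 ≠ 0 := by intro h; apply hn0; simp [h]
  have hB : t ^ 2 - 5 * t + 8 ≠ 0 := by intro h; apply hn0; simp [h]
  have hQ : t ^ 4 - 5 * t ^ 3 + 8 * t ^ 2 - 7 * t + 7 ≠ 0 := by intro h; apply hn0; simp [h]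
  have hv := congrArg (padicValRat 7) hid
  rw [padicValRat.mul hj (pow_ne_zero 7 hc), padicValRat.pow,
    padicValRat.mul (mul_ne_zero (mul_ne_zero (mul_ne_zero ht0 (pow_ne_zero 3 h1)) (pow_ne_zero 3 hA)) (pow_ne_zero 3 hB))
      (pow_ne_zero 3 hQ),
    padicValRat.mul (mul_ne_zero (mul_ne_zero ht0 (pow_ne_zero 3 h1)) (pow_ne_zero 3 hA)) (pow_ne_zero 3 hB),
    padicValRat.mul (mul_ne_zero ht0 (pow_ne_zero 3 h1)) (pow_ne_zero 3 hA),
    padicValRat.mul ht0 (pow_ne_zero 3 h1), padicValRat.pow, padicValRat.pow, padicValRat.pow, padicValRat.pow,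
    padicValRat_t_add_one_of_neg ht h1, padicValRat_quad_of_neg ht one_ne_zero padicValRat.one hA,
    padicValRat_quad_of_neg ht (by norm_num) padicValRat_seven_consts.2.1 hB,
    padicValRat_Q_of_neg ht hQ, padicValRat_c_of_neg ht hc] at hv
  push_cast at hv
  linarith

/-- **For `v₇(t) ≥ 0`: `v₇(j) ≥ 0`** whenever `j·c(t)⁷ = n(t)` with `j ≠ 0`, `c(t) ≠ 0`. If `7 ∤ c(t)`: `v(j) = v(n) ≥ 0`. If
`7 ∣ c(t)` (`c = (t+1)³ − 7t²`): `v(t+1) ≥ 1`, `v(t) = 0`, `v(c) = 1`, and `v(n) ≥ 12` because `t²−5t+1 = (t+1)² − 7t`,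
`t²−5t+8 = (t+1)² − 7(t−1)`, `t⁴−5t³+8t²−7t+7 = t²(t+1)² − 7(t−1)(t²+1)` are divisible by `7`; so `v(j) = v(n) − 7 ≥ 5`.
[cite: Zywina2015, §1.4 (J₂)] -/
theorem padicValRat_J2_nonneg_of_nonneg (ht : 0 ≤ padicValRat 7 t) {j : ℚ} (hj : j ≠ 0)
    (hc : t ^ 3 - 4 * t ^ 2 + 3 * t + 1 ≠ 0) (hid : j * (t ^ 3 - 4 * t ^ 2 + 3 * t + 1) ^ 7 = t * (t + 1) ^ 3 *
      (t ^ 2 - 5 * t + 1) ^ 3 * (t ^ 2 - 5 * t + 8) ^ 3 * (t ^ 4 - 5 * t ^ 3 + 8 * t ^ 2 - 7 * t + 7) ^ 3) :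
    0 ≤ padicValRat 7 j := by
  haveI : Fact (Nat.Prime 7) := ⟨by norm_num⟩
  obtain ⟨h5, h8, h4, h3, h7⟩ := padicValRat_seven_consts
  have hn0 : t * (t + 1) ^ 3 * (t ^ 2 - 5 * t + 1) ^ 3 * (t ^ 2 - 5 * t + 8) ^ 3 *
      (t ^ 4 - 5 * t ^ 3 + 8 * t ^ 2 - 7 * t + 7) ^ 3 ≠ 0 := hid ▸ mul_ne_zero hj (pow_ne_zero 7 hc)
  have ht0 : t ≠ 0 := by intro h; apply hn0; simp [h]
  have h1 : t + 1 ≠ 0 := by intro h; apply hn0; simp [h]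
  have hA : t ^ 2 - 5 * t + 1 ≠ 0 := by intro h; apply hn0; simp [h]
  have hB : t ^ 2 - 5 * t + 8 ≠ 0 := by intro h; apply hn0; simp [h]
  have hQ : t ^ 4 - 5 * t ^ 3 + 8 * t ^ 2 - 7 * t + 7 ≠ 0 := by intro h; apply hn0; simp [h]
  -- every polynomial value has nonnegative valuation
  have hvt1 : 0 ≤ padicValRat 7 (t + 1) :=
    le_padicValRat_add_of_nonpos le_rfl ht (by rw [padicValRat.one])
  have hvt2 : 0 ≤ padicValRat 7 (t ^ 2) := X1Eleven.padicValRat_pow_nonneg 7 ht 2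
  have hv5t : 0 ≤ padicValRat 7 (-(5 * t)) := by
    rw [padicValRat.neg]; exact X1Eleven.padicValRat_mul_nonneg 7 (by rw [h5]) ht
  have hvA : 0 ≤ padicValRat 7 (t ^ 2 - 5 * t + 1) := by
    rw [sub_eq_add_neg]
    exact le_padicValRat_add_of_nonpos le_rfl (le_padicValRat_add_of_nonpos le_rfl hvt2 hv5t) (by rw [padicValRat.one])
  have hvB : 0 ≤ padicValRat 7 (t ^ 2 - 5 * t + 8) := by
    rw [sub_eq_add_neg]
    exact le_padicValRat_add_of_nonpos le_rfl (le_padicValRat_add_of_nonpos le_rfl hvt2 hv5t) (by rw [h8])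
  have hvQ : 0 ≤ padicValRat 7 (t ^ 4 - 5 * t ^ 3 + 8 * t ^ 2 - 7 * t + 7) := by
    have e : t ^ 4 - 5 * t ^ 3 + 8 * t ^ 2 - 7 * t + 7 = t ^ 4 + -(5 * t ^ 3) + 8 * t ^ 2 + -(7 * t) + 7 := by ring
    rw [e]
    refine le_padicValRat_add_of_nonpos le_rfl (le_padicValRat_add_of_nonpos le_rfl
      (le_padicValRat_add_of_nonpos le_rfl (le_padicValRat_add_of_nonpos le_rfl (X1Eleven.padicValRat_pow_nonneg 7 ht 4) ?_) ?_) ?_)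
      (by rw [h7]; norm_num)
    · rw [padicValRat.neg]; exact X1Eleven.padicValRat_mul_nonneg 7 (by rw [h5]) (X1Eleven.padicValRat_pow_nonneg 7 ht 3)
    · exact X1Eleven.padicValRat_mul_nonneg 7 (by rw [h8]) hvt2
    · rw [padicValRat.neg]; exact X1Eleven.padicValRat_mul_nonneg 7 (by rw [h7]; norm_num) ht
  have hvc : 0 ≤ padicValRat 7 (t ^ 3 - 4 * t ^ 2 + 3 * t + 1) := by
    have e : t ^ 3 - 4 * t ^ 2 + 3 * t + 1 = t ^ 3 + -(4 * t ^ 2) + 3 * t + 1 := by ring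
    rw [e]
    refine le_padicValRat_add_of_nonpos le_rfl (le_padicValRat_add_of_nonpos le_rfl
      (le_padicValRat_add_of_nonpos le_rfl (X1Eleven.padicValRat_pow_nonneg 7 ht 3) ?_) ?_) (by rw [padicValRat.one])
    · rw [padicValRat.neg]; exact X1Eleven.padicValRat_mul_nonneg 7 (by rw [h4]) hvt2
    · exact X1Eleven.padicValRat_mul_nonneg 7 (by rw [h3]) ht
  -- the identity in valuations
  have hv := congrArg (padicValRat 7) hid
  rw [padicValRat.mul hj (pow_ne_zero 7 hc), padicValRat.pow,
    padicValRat.mul (mul_ne_zero (mul_ne_zero (mul_ne_zero ht0 (pow_ne_zero 3 h1)) (pow_ne_zero 3 hA)) (pow_ne_zero 3 hB))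
      (pow_ne_zero 3 hQ),
    padicValRat.mul (mul_ne_zero (mul_ne_zero ht0 (pow_ne_zero 3 h1)) (pow_ne_zero 3 hA)) (pow_ne_zero 3 hB),
    padicValRat.mul (mul_ne_zero ht0 (pow_ne_zero 3 h1)) (pow_ne_zero 3 hA),
    padicValRat.mul ht0 (pow_ne_zero 3 h1), padicValRat.pow, padicValRat.pow, padicValRat.pow, padicValRat.pow] at hv
  push_cast at hv
  by_cases hc7 : padicValRat 7 (t ^ 3 - 4 * t ^ 2 + 3 * t + 1) = 0
  · -- `7 ∤ c(t)`: `v(j) = v(n) ≥ 0`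
    rw [hc7] at hv; nlinarith
  · -- `7 ∣ c(t)`: then `v(t+1) ≥ 1`, `v(t) = 0`, `v(c) = 1`, `v(n) ≥ 12`
    have hvc1 : 1 ≤ padicValRat 7 (t ^ 3 - 4 * t ^ 2 + 3 * t + 1) := by omega
    have ec : t ^ 3 - 4 * t ^ 2 + 3 * t + 1 = -(7 * t ^ 2) + (t + 1) ^ 3 := by ring
    have hv7t2 : padicValRat 7 (-(7 * t ^ 2)) = 1 + 2 * padicValRat 7 t := by
      rw [padicValRat.neg, padicValRat.mul (by norm_num) (pow_ne_zero 2 ht0), h7, padicValRat.pow]; push_cast; ring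
    -- `v(t+1) ≥ 1`
    have hvt1' : 1 ≤ padicValRat 7 (t + 1) := by
      by_contra hlt
      have h0 : padicValRat 7 (t + 1) = 0 := le_antisymm (by omega) hvt1
      have hcub : padicValRat 7 ((t + 1) ^ 3) = 0 := by rw [padicValRat.pow, h0, mul_zero]
      -- then `v(c) = v((t+1)³ + (−7t²)) = 0`
      have := padicValRat.add_eq_of_lt (p := 7) (q := (t + 1) ^ 3) (r := -(7 * t ^ 2))
        (by rw [add_comm, ← ec]; exact hc) (pow_ne_zero 3 h1) (by simpa using pow_ne_zero 2 ht0)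
        (by rw [hcub, hv7t2]; linarith)
      rw [add_comm, ← ec, hcub] at this
      exact hc7 this
    -- `v(t) = 0`
    have hvt0 : padicValRat 7 t = 0 := by
      have et : t = -1 + (t + 1) := by ring
      have := padicValRat.add_eq_of_lt (p := 7) (q := (-1 : ℚ)) (r := t + 1) (by rw [← et]; exact ht0) (by norm_num) h1
        (by rw [padicValRat.neg, padicValRat.one]; omega)
      rw [← et, padicValRat.neg, padicValRat.one] at this
      exact this
    -- `v(c) = 1`
    have hvc_eq : padicValRat 7 (t ^ 3 - 4 * t ^ 2 + 3 * t + 1) = 1 := by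
      have := padicValRat.add_eq_of_lt (p := 7) (q := -(7 * t ^ 2)) (r := (t + 1) ^ 3) (by rw [← ec]; exact hc)
        (by simpa using pow_ne_zero 2 ht0) (pow_ne_zero 3 h1) (by rw [hv7t2, padicValRat.pow, hvt0]; push_cast; nlinarith)
      rw [← ec, hv7t2, hvt0] at this; simpa using this
    -- the three quadratic/quartic factors are divisible by `7`
    have h71 : (1 : ℤ) ≤ padicValRat 7 (7 : ℚ) := by rw [h7]
    have hsq : 1 ≤ padicValRat 7 ((t + 1) ^ 2) := by rw [padicValRat.pow]; push_cast; nlinarith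
    have hvA1 : 1 ≤ padicValRat 7 (t ^ 2 - 5 * t + 1) := by
      have e : t ^ 2 - 5 * t + 1 = (t + 1) ^ 2 + -(7 * t) := by ring
      rw [e]
      refine le_padicValRat_add_of_ne_zero (e ▸ hA) hsq ?_
      rw [padicValRat.neg, padicValRat.mul (by norm_num) ht0, h7, hvt0]; norm_num
    have hvB1 : 1 ≤ padicValRat 7 (t ^ 2 - 5 * t + 8) := by
      have e : t ^ 2 - 5 * t + 8 = (t + 1) ^ 2 + -(7 * (t - 1)) := by ring
      by_cases ht1 : t - 1 = 0
      · rw [e, ht1, mul_zero, neg_zero, add_zero]; exact hsq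
      rw [e]
      refine le_padicValRat_add_of_ne_zero (e ▸ hB) hsq ?_
      rw [padicValRat.neg, padicValRat.mul (by norm_num) ht1, h7]
      have : 0 ≤ padicValRat 7 (t - 1) := by
        rw [sub_eq_add_neg]; exact le_padicValRat_add_of_nonpos le_rfl ht (by rw [padicValRat.neg, padicValRat.one])
      linarith
    have hvQ1 : 1 ≤ padicValRat 7 (t ^ 4 - 5 * t ^ 3 + 8 * t ^ 2 - 7 * t + 7) := by
      have e : t ^ 4 - 5 * t ^ 3 + 8 * t ^ 2 - 7 * t + 7 = t ^ 2 * (t + 1) ^ 2 + -(7 * ((t - 1) * (t ^ 2 + 1))) := by ring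
      have hsq' : 1 ≤ padicValRat 7 (t ^ 2 * (t + 1) ^ 2) := by
        have := le_padicValRat_mul (p := 7) (pow_ne_zero 2 ht0) (pow_ne_zero 2 h1) hvt2 hsq
        simpa using this
      by_cases ht1 : t - 1 = 0
      · rw [e, ht1, zero_mul, mul_zero, neg_zero, add_zero]; exact hsq'
      have ht21 : t ^ 2 + 1 ≠ 0 := by positivity
      rw [e]
      refine le_padicValRat_add_of_ne_zero (e ▸ hQ) hsq' ?_
      rw [padicValRat.neg, padicValRat.mul (by norm_num) (mul_ne_zero ht1 ht21), h7, padicValRat.mul ht1 ht21]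
      have h1' : 0 ≤ padicValRat 7 (t - 1) := by
        rw [sub_eq_add_neg]; exact le_padicValRat_add_of_nonpos le_rfl ht (by rw [padicValRat.neg, padicValRat.one])
      have h2' : 0 ≤ padicValRat 7 (t ^ 2 + 1) := le_padicValRat_add_of_nonpos le_rfl hvt2 (by rw [padicValRat.one])
      linarith
    rw [hvc_eq, hvt0] at hv
    linarith

end Factors

/-! ### §2. A multiplicative `7` on the `J₂`-line -/

variable (W : WeierstrassCurve ℚ) [W.IsElliptic] [W.IsGloballyMinimal]

/-- **A multiplicative `7` on the `J₂`-line forces `v₇(t) < 0`**: `v₇(j) = −v₇(Δ_min) ≤ −1 < 0`, while `v₇(t) ≥ 0` would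
give `v₇(j) ≥ 0`. [cite: SilvermanAEC2009, VII.5 Prop. 5.1] [cite: Zywina2015, §1.4 (J₂)] -/
theorem padicValRat_lt_zero_of_mult_of_j_eq_J2 [Fact (Nat.Prime 7)] (hmult : Mult W 7) {t : ℚ}
    (hc : t ^ 3 - 4 * t ^ 2 + 3 * t + 1 ≠ 0) (hid : W.j * (t ^ 3 - 4 * t ^ 2 + 3 * t + 1) ^ 7 = t * (t + 1) ^ 3 *
      (t ^ 2 - 5 * t + 1) ^ 3 * (t ^ 2 - 5 * t + 8) ^ 3 * (t ^ 4 - 5 * t ^ 3 + 8 * t ^ 2 - 7 * t + 7) ^ 3) : padicValRat 7 t < 0 := by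
  rcases lt_or_ge (padicValRat 7 t) 0 with h | h
  · exact h
  · exfalso
    have hv := Fouquet2025.padicValRat_j_of_hasMultiplicativeReductionAtPrime W 7 hmult
    have h1 := one_le_padicValInt_minimalDiscriminantInt W hmult
    have hj0 : W.j ≠ 0 := by
      intro h0; rw [h0, padicValRat.zero] at hv; omega
    have h0 := padicValRat_J2_nonneg_of_nonneg h hj0 hc hid
    omega

/-- **`v₇(Δ_min) = −7·v₇(t)` for a multiplicative `7` on the `J₂`-line** (`v₇(j) = 7v₇(t)` and `v₇(j) = −v₇(Δ_min)`).
[cite: SilvermanAEC2009, VII.5 Prop. 5.1] [cite: Zywina2015, §1.4 (J₂)] -/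
theorem ordMinimalDiscriminant_eq_of_mult_of_j_eq_J2 [Fact (Nat.Prime 7)] (hmult : Mult W 7) {t : ℚ}
    (hc : t ^ 3 - 4 * t ^ 2 + 3 * t + 1 ≠ 0) (hid : W.j * (t ^ 3 - 4 * t ^ 2 + 3 * t + 1) ^ 7 = t * (t + 1) ^ 3 *
      (t ^ 2 - 5 * t + 1) ^ 3 * (t ^ 2 - 5 * t + 8) ^ 3 * (t ^ 4 - 5 * t ^ 3 + 8 * t ^ 2 - 7 * t + 7) ^ 3) :
    (padicValInt 7 W.minimalDiscriminantInt : ℤ) = -7 * padicValRat 7 t := by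
  have ht := padicValRat_lt_zero_of_mult_of_j_eq_J2 W hmult hc hid
  have hv := Fouquet2025.padicValRat_j_of_hasMultiplicativeReductionAtPrime W 7 hmult
  have hj0 : W.j ≠ 0 := by
    intro h0; rw [h0, padicValRat.zero] at hv
    have h1 := one_le_padicValInt_minimalDiscriminantInt W hmult
    omega
  have h7 := padicValRat_J2_of_neg ht hj0 hc hid
  rw [hv] at h7
  linarith

/-- **`7 ∣ v₇(Δ_min)`** for a multiplicative `7` on the `J₂`-line — the crux binder, from the curve. [cite: Zywina2015, §1.4 (J₂)] -/
theorem seven_dvd_ordMinimalDiscriminant_of_mult_of_j_eq_J2 [Fact (Nat.Prime 7)] (hmult : Mult W 7) {t : ℚ}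
    (hc : t ^ 3 - 4 * t ^ 2 + 3 * t + 1 ≠ 0) (hid : W.j * (t ^ 3 - 4 * t ^ 2 + 3 * t + 1) ^ 7 = t * (t + 1) ^ 3 *
      (t ^ 2 - 5 * t + 1) ^ 3 * (t ^ 2 - 5 * t + 8) ^ 3 * (t ^ 4 - 5 * t ^ 3 + 8 * t ^ 2 - 7 * t + 7) ^ 3) :
    (7 : ℤ) ∣ padicValInt 7 W.minimalDiscriminantInt :=
  ⟨-padicValRat 7 t, by rw [ordMinimalDiscriminant_eq_of_mult_of_j_eq_J2 W hmult hc hid]; ring⟩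

/-- **`7 ≤ v₇(Δ_min)`** for a multiplicative `7` on the `J₂`-line (`v₇(t) ≤ −1`). [cite: Zywina2015, §1.4 (J₂)] -/
theorem seven_le_ordMinimalDiscriminant_of_mult_of_j_eq_J2 [Fact (Nat.Prime 7)] (hmult : Mult W 7) {t : ℚ}
    (hc : t ^ 3 - 4 * t ^ 2 + 3 * t + 1 ≠ 0) (hid : W.j * (t ^ 3 - 4 * t ^ 2 + 3 * t + 1) ^ 7 = t * (t + 1) ^ 3 *
      (t ^ 2 - 5 * t + 1) ^ 3 * (t ^ 2 - 5 * t + 8) ^ 3 * (t ^ 4 - 5 * t ^ 3 + 8 * t ^ 2 - 7 * t + 7) ^ 3) :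
    (7 : ℤ) ≤ padicValInt 7 W.minimalDiscriminantInt := by
  have ht := padicValRat_lt_zero_of_mult_of_j_eq_J2 W hmult hc hid
  rw [ordMinimalDiscriminant_eq_of_mult_of_j_eq_J2 W hmult hc hid]
  omega

/-! ### §3. On the corner -/

/-- **THE PARAMETER OF A CORNER PAIR AT `7`**: every corner pair `(E, 7)` (`ClassX11b W 7`, `ρ̄_{E,7}` not onto) has
`j(E)·c(t)⁷ = n(t)` for some `t ∈ ℚ` with `c(t) ≠ 0`, `v₇(t) < 0` and `v₇(Δ_min(E)) = −7·v₇(t)` (given Zywina's Thm. 1.5,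
`i = 2`, «only if» by name: `hZ`). Every known member has `v₇(t) = −1`, `v₇(Δ_min) = 7`.
[cite: Zywina2015, Thm. 1.5 (second item, i = 2), §1.4] [cite: SilvermanAEC2009, VII.5 Prop. 5.1] -/
theorem NonSurjCorner.exists_t_seven [Fact (Nat.Prime 7)]
    (hZ : Literature.NumberTheory.EllipticCurves.zywina2015_thm15_exists_j_eq_J2_of_splitCartanNormalizer_seven)
    (hX : ClassX11b W 7) (hns : ¬ Surj W 7) :
    ∃ t : ℚ, t ^ 3 - 4 * t ^ 2 + 3 * t + 1 ≠ 0 ∧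
      W.j * (t ^ 3 - 4 * t ^ 2 + 3 * t + 1) ^ 7 =
        t * (t + 1) ^ 3 * (t ^ 2 - 5 * t + 1) ^ 3 * (t ^ 2 - 5 * t + 8) ^ 3 *
          (t ^ 4 - 5 * t ^ 3 + 8 * t ^ 2 - 7 * t + 7) ^ 3 ∧
      padicValRat 7 t < 0 ∧ (padicValInt 7 W.minimalDiscriminantInt : ℤ) = -7 * padicValRat 7 t := by
  obtain ⟨t, hc, hid⟩ := NonSurjCorner.exists_j_eq_J2_seven W hZ hX hns
  exact ⟨t, hc, hid, padicValRat_lt_zero_of_mult_of_j_eq_J2 W hX.2.2.1 hc hid,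
    ordMinimalDiscriminant_eq_of_mult_of_j_eq_J2 W hX.2.2.1 hc hid⟩

end Summit.BirchSwinnertonDyer.BirchSwinnertonDyer.Theorems.CornerShape

end
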